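import Summits.BirchSwinnertonDyer.BirchSwinnertonDyer.Theorems.ClassRecordThreeEulerHalvesAtThreeWalkCebotarev
import Summits.BirchSwinnertonDyer.BirchSwinnertonDyer.Theorems.ErratumRoadFiveShimuraKolyvaginOrderBoundInertShiftCebotarev
import Summits.BirchSwinnertonDyer.BirchSwinnertonDyer.Theorems.ClassRecordThreeShimuraKolyvaginCebotarevOfImageOdd
import Summits.BirchSwinnertonDyer.BirchSwinnertonDyer.Theorems.ClassRecordThreeShimuraKolyvaginFixedOfTorsion
import HarnessLib

/-!
# Route `ErratumRoadFive` (rung K2), crux child `NonSurjCornerKolyJ` (item stmt-BirchSwinnertonDyer-19947), registered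
# stub `stub_kolyJ_max`: the walk's Čebotarev input ([J] Lemma 6.1, DECOUPLED, level `p^k`, index `≥ k + j`) ON THE
# IRREDUCIBLE NON-SURJECTIVE CELL — `ρ̄_{E,p}` onto replaced by «`E[p]` irreducible with `−1 ∈ ρ̄_{E,p}(Γ_ℚ)`»
# (cell `bsd-stepL`, seat `bsd-stepL-corner-p1` g7; `--supports stmt-BirchSwinnertonDyer-19947`)

WHAT. tam3-p1's instantiated §6 walk (`Koly.tamagawaExponent_le_m_of_admissibleFamilies`, `…WalkFamiliesAdm`, p497855)
= the kernel road to `stub_kolyJ_max` (Jetchev's MAX form at `p ∥ N` on corner frames) and to 19109's stub. Its h61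
input was DISCHARGED by tam3 (`Koly.exists_kolyvaginPrime_addOrderOf_localization_eq_shift`, `…WalkCebotarev`, p494064)
under `ρ̄_{E,p}` ONTO, used in exactly two places: the injectivity of the level change
`ι_* : H¹(K,E[p^k]) ↪ H¹(K,E[p^{k+j}])` (`E(K)[p] = 0`) and x11b3's level-`p^{k+j}` McCallum Cor. 3.2
(`McCallum1991_cor_3_2_pow_of_chebotarev`). On the (T4′) corner `ρ̄` is NOT onto; both inputs have landed twins on the
irreducible cell: shim3b g4's `ShimuraKolyvaginFixedOfTorsion.torsionH1OfDvd_pow_injective_of_torsionBy_eq_bot` (any `K`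
with `E(K)[p] = 0` — here from `torsionBy_eq_bot_of_isImaginaryQuadratic_of_hasIrreducibleModPGaloisRep`) and
`ShimuraKolyvaginCebotarevOfImageOdd.McCallum1991_cor_3_2_pow_of_irr_of_neg` (ANY odd `p`, `E[p]` irreducible with
`−1 ∈ ρ̄_{E,p}(Γ_ℚ)`, under Gross's disjointness: a prime `q ∣ d_K` with `q ∤ N_E`, `q ≠ p` — automatic for a Heegner
field). The corner images at `p = 5` (5S4, N(C_s)) and `p = 7` (N(C_s), N(C_ns)) contain `−1`; the hypothesis is
carried as `hneg` and discharged per image type by the caller.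

* §1 **`McCallum1991_cor_3_2_pow_shift_of_irr_of_neg`** — shim-p1 g8's `McCallum1991_cor_3_2_pow_shift_of_chebotarev`
  (Cor. 3.2 at level `p^M` with Kolyvagin primes of DEPTH `M + k`) verbatim with the two replacements.
* §2 **`exists_kolyvaginPrime_addOrderOf_localization_eq_shift_of_irr_of_neg`** — tam3's decoupled [J] Lemma 6.1 in
  the walk's localisation currency, same replacement: for `τ`-eigenclasses `x` (sign `e`) and `y ≠ 0` (sign `−e`) in
  `H¹(K, E[p^k])` and any bound, a Zhang–Kolyvagin prime `ℓ` of index `≥ k + j` whose localisation preserves both orders.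

With `…NonSurjCornerKolyJWalkOrders.lean` (S7 `hordκ`, S7♯ algebraic half on the irreducible cell) every Galois-image
input of the corner walk now has its kernel twin; the remaining named inputs of `stub_kolyJ_max` are EXACTLY those of
19109's `stub_jetchevMaxHLAtThree` (the structures 𝒯 ∕ 𝒮, hdisj · hfin · hPT · hκt-Selmer half · h47 · hC · hdual_q ·
h49 · hdual_ℓ — with the `v ∣ p` clause of h49 ∕ hdual_q supplied on paper by CORNER-G7.md §1) plus `hneg`.
HONEST FRAMING: two theorems (no definition, no named fact, no `sorry`); `stub_kolyJ_max` is NOT discharged; nothing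
asserted about any curve; no item closes; BSD not advanced (T7).

References: [Jetchev2008] Lemma 5.1 (p. 821) = arXiv Lemma 6.1, Rem. 6.2; [McCallumLMS1991] §3 Prop. 3.1, Cor. 3.2,
§4 Lemma 4.6; [GrossLMS1991] §3 (3.1)–(3.3), §9, Lemma 4.3; [MatarNekovar2019] Prop. 5.26 (2); [Cha2005] Lemmas 22–23;
tree: shim-p1 p48xxxx `…InertShiftCebotarev`, shim3b g4 `…CebotarevOfImageOdd` ∕ `…FixedOfTorsion`, tam3 p494064.
-/

set_option autoImplicit false
set_option linter.dupNamespace false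

noncomputable section

open scoped Classical Pointwise NumberField

/-! ### §1 McCallum's Cor. 3.2 one level deeper, irreducible image containing `−1` -/

namespace Summit.BirchSwinnertonDyer.BirchSwinnertonDyer.Theorems

open WeierstrassCurve NumberField IsDedekindDomain Field
  Literature.NumberTheory.EllipticCurves Literature.NumberTheory.GaloisRepresentations
  Summit.BirchSwinnertonDyer.Rank1Residual

universe u

section Main

variable {W : WeierstrassCurve ℚ} {K : Type u} [Field K] [NumberField K]

/-- **McCallum 1991, Cor. 3.2 ONE LEVEL DEEPER (Kolyvagin primes of depth `M + k`, prescribed local orders of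
level-`p^M` classes) — for `E[p]` IRREDUCIBLE with `−1 ∈ ρ̄_{E,p}(Γ_ℚ)`, any odd `p`.** shim-p1's
`McCallum1991_cor_3_2_pow_shift_of_chebotarev` verbatim, with `ι_*`-injectivity from `E(K)[p] = 0` on the irreducible
cell (`torsionBy_eq_bot_of_isImaginaryQuadratic_of_hasIrreducibleModPGaloisRep` +
`ShimuraKolyvaginFixedOfTorsion.torsionH1OfDvd_pow_injective_of_torsionBy_eq_bot`) and the level-`p^{M+k}` Čebotarev
step from `ShimuraKolyvaginCebotarevOfImageOdd.McCallum1991_cor_3_2_pow_of_irr_of_neg` (Gross's disjointness: a prime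
`q ∣ d_K`, `q ∤ N`, `q ≠ p`). UNCONDITIONAL (Čebotarev and the Weil pairing are tree theorems).
[cite: McCallumLMS1991, §3 Cor. 3.2 (with Prop. 3.1), §4 Lemma 4.6] [cite: Jetchev2008, Rem. 6.2 (p. 821)]
[cite: GrossLMS1991, §3 (3.2), §9] [cite: MatarNekovar2019, Prop. 5.26 (2)] -/
theorem McCallum1991_cor_3_2_pow_shift_of_irr_of_neg
    {N : ℕ} [NeZero N] [W.IsElliptic] (hNW : W.conductorNorm ℤ = N) (hK : IsImaginaryQuadratic K)
    {p : ℕ} (hp : p.Prime) (hp2 : p ≠ 2) (hirr : W.HasIrreducibleModPGaloisRep p)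
    (hneg : ∃ γ : absoluteGaloisGroup ℚ, ∀ P : geomTorsion W p, γ • P = -P)
    {q : ℕ} (hq : q.Prime) (hqd : (q : ℤ) ∣ NumberField.discr K) (hqN : ¬ q ∣ N) (hqp : q ≠ p)
    {M : ℕ} (hM : 1 ≤ M) (k : ℕ) {c : K ≃ₐ[ℚ] K} (hc : c ≠ 1) {r : ℕ}
    (cs : Fin r → galH1Torsion (W.baseChange K) ((p ^ M : ℕ) : ℤ)) (h0 : ∀ i, cs i ≠ 0)
    (Nv : Fin r → ℕ) (hN : ∀ i, Nv i ≠ 0 → ((p : ℤ) ^ (Nv i - 1)) • cs i ≠ 0)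
    (hτ : ∀ i, ∃ e : ℤ, (e = 1 ∨ e = -1) ∧ conjAct W c ((p ^ M : ℕ) : ℤ) (cs i) = e • cs i)
    (hind : ∀ a : Fin r → ℤ, ∑ i, a i • cs i = 0 → ∀ i, a i • cs i = 0) (b : ℕ) :
    ∃ ℓ : ℕ, b < ℓ ∧ IsKolyvaginPrime N W K p ℓ ∧ FrobEqFrobInfty W K (p ^ (M + k)) ℓ ∧
      ∀ i, ∀ v : HeightOneSpectrum (𝓞 K), (ℓ : 𝓞 K) ∈ v.asIdeal →
        (((p : ℤ) ^ Nv i) • cs i ∈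
            (W.baseChange K).torsionLocalKer (v.adicCompletion K) ((p ^ M : ℕ) : ℤ) ∧
          (Nv i ≠ 0 → ((p : ℤ) ^ (Nv i - 1)) • cs i ∉
            (W.baseChange K).torsionLocalKer (v.adicCompletion K) ((p ^ M : ℕ) : ℤ))) := by
  classical
  haveI : (W.baseChange K).IsElliptic := inferInstanceAs (W.map (algebraMap ℚ K)).IsElliptic
  have hdvd := natCast_pow_dvd_natCast_pow_add p M k
  set ι := torsionH1OfDvd (W.baseChange K) hdvd with hιdef
  -- injectivity of the level change from `E(K)[p] = 0` (irreducible cell)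
  have hιinj : Function.Injective ι :=
    ShimuraKolyvaginFixedOfTorsion.torsionH1OfDvd_pow_injective_of_torsionBy_eq_bot W
      (torsionBy_eq_bot_of_isImaginaryQuadratic_of_hasIrreducibleModPGaloisRep W K hK hp hirr) M k
  -- ### the shifted classes `ι_* c_i ∈ H¹(K, E[p^{M+k}])`
  set cs' : Fin r → galH1Torsion (W.baseChange K) ((p ^ (M + k) : ℕ) : ℤ) := fun i ↦ ι (cs i)
    with hcs'
  have h0' : ∀ i, cs' i ≠ 0 := fun i h ↦ h0 i (hιinj (by rw [map_zero]; exact h))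
  have hN' : ∀ i, Nv i ≠ 0 → ((p : ℤ) ^ (Nv i - 1)) • cs' i ≠ 0 := fun i hi h ↦
    hN i hi (hιinj (by rw [map_zsmul, map_zero]; exact h))
  have hτ' : ∀ i, ∃ e : ℤ, (e = 1 ∨ e = -1) ∧
      conjAct W c ((p ^ (M + k) : ℕ) : ℤ) (cs' i) = e • cs' i := fun i ↦ by
    obtain ⟨e, he, hec⟩ := hτ i
    exact ⟨e, he, by rw [hcs', conjAct_torsionH1OfDvd, hec, map_zsmul]⟩
  have hind' : ∀ a : Fin r → ℤ, ∑ i, a i • cs' i = 0 → ∀ i, a i • cs' i = 0 := by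
    intro a ha i
    have hsum : ι (∑ j, a j • cs j) = 0 := by
      rw [map_sum]
      simpa only [map_zsmul] using ha
    have h := hind a (hιinj (by rw [hsum, map_zero])) i
    change a i • ι (cs i) = 0
    rw [← map_zsmul, h, map_zero]
  -- ### the bound: above `b` and above the rational primes under the bad places of `E/K`
  have hbad : ((W.baseChange K).badPlaces (𝓞 K)).Finite := (W.baseChange K).finite_badPlaces_holds (𝓞 K)
  set B : ℕ := hbad.toFinset.sup fun w ↦ (Rat.HeightOneSpectrum.primesEquiv (w.under (𝓞 ℚ)) : ℕ)
    with hB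
  have hM' : 1 ≤ M + k := le_trans hM (Nat.le_add_right M k)
  obtain ⟨ℓ, hbℓ, hKol, hfrob, hloc⟩ :=
    ShimuraKolyvaginCebotarevOfImageOdd.McCallum1991_cor_3_2_pow_of_irr_of_neg W K hNW hp hp2 hirr hneg hK
      hq hqd hqN hqp hM' hc cs' h0' Nv hN' hτ' hind' (max b B)
  have hb : b < ℓ := lt_of_le_of_lt (le_max_left b B) hbℓ
  have hBℓ : B < ℓ := lt_of_le_of_lt (le_max_right b B) hbℓ
  -- ### good reduction at `λ`
  have hgood : hKol.place ∉ (W.baseChange K).badPlaces (𝓞 K) := by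
    intro hmem
    have hle : (Rat.HeightOneSpectrum.primesEquiv (hKol.place.under (𝓞 ℚ)) : ℕ) ≤ B :=
      Finset.le_sup (f := fun w : HeightOneSpectrum (𝓞 K) ↦
        (Rat.HeightOneSpectrum.primesEquiv (w.under (𝓞 ℚ)) : ℕ)) (hbad.mem_toFinset.mpr hmem)
    have hℓeq : (Rat.HeightOneSpectrum.primesEquiv (hKol.place.under (𝓞 ℚ)) : ℕ) = ℓ := by
      rw [(natCast_mem_asIdeal_iff_eq_primesEquiv_symm _ hKol.prime).mp hKol.natCast_mem_under,
        Equiv.apply_symm_apply]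
    omega
  -- ### `Γ_{K_λ}` fixes `E[p^{M+k}]`
  haveI : NeZero (p ^ (M + k)) := ⟨pow_ne_zero _ hp.ne_zero⟩
  have hpv : ((p : ℕ) : 𝓞 K) ∉ hKol.place.asIdeal :=
    not_natCast_mem_of_prime_ne hKol.prime hp hKol.2.2.2.1 hKol.place hKol.mem_place
  have hqv : ((((p ^ (M + k) : ℕ) : ℤ)) : 𝓞 K) ∉ hKol.place.asIdeal := by
    rw [Int.cast_natCast, Nat.cast_pow]
    exact fun h ↦ hpv (hKol.place.isPrime.mem_of_pow_mem (M + k) h)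
  have htriv : ∀ (g : absoluteGaloisGroup (hKol.place.adicCompletion K))
      (Q : geomTorsion (W.baseChange K) ((p ^ (M + k) : ℕ) : ℤ)),
      resGal (K := K) (hKol.place.adicCompletion K) g • Q = Q := fun g Q ↦ by
    rw [resGal_eq_absGaloisRestrict]
    exact absGaloisRestrict_smul_geomTorsion_eq_of_kolyvaginPrime W hK hKol hfrob hgood hqv g Q
  -- ### assemble
  refine ⟨ℓ, hb, hKol, hfrob, fun i v hv ↦ ?_⟩
  rw [hKol.mem_iff.mp hv]
  have key := hloc i hKol.place hKol.mem_place
  have hpd : p ^ M ∣ p ^ (M + k) := pow_dvd_pow p (Nat.le_add_right M k)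
  have hpM : p ^ M ≠ 0 := pow_ne_zero M hp.ne_zero
  have hpMk : p ^ (M + k) ≠ 0 := pow_ne_zero _ hp.ne_zero
  have e1 := mem_torsionLocalKer_iff_torsionH1OfDvd_mem (W.baseChange K) (hKol.place.adicCompletion K)
    hpd hpM hpMk htriv (((p : ℤ) ^ Nv i) • cs i)
  have e2 := mem_torsionLocalKer_iff_torsionH1OfDvd_mem (W.baseChange K) (hKol.place.adicCompletion K)
    hpd hpM hpMk htriv (((p : ℤ) ^ (Nv i - 1)) • cs i)
  rw [map_zsmul] at e1 e2
  exact ⟨e1.mpr key.1, fun hi h ↦ key.2 hi (e2.mp h)⟩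

end Main

end Summit.BirchSwinnertonDyer.BirchSwinnertonDyer.Theorems

/-! ### §2 [J] Lemma 6.1 decoupled, irreducible image containing `−1` -/

namespace Summit.BirchSwinnertonDyer.Rank1Residual.X11b.Three.Koly

open WeierstrassCurve IsDedekindDomain NumberField Literature.NumberTheory.EllipticCurves
  Literature.NumberTheory.EllipticCurves.ModularForms Literature.NumberTheory.GaloisRepresentations
  Summit.BirchSwinnertonDyer.BirchSwinnertonDyer.Theorems

variable (W : WeierstrassCurve ℚ) [W.IsElliptic] [W.IsGloballyMinimal] [NeZero (W.conductorNorm ℤ)]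
  {K : Type} [Field K] [NumberField K]

/-- **[J] Lemma 6.1 DECOUPLED — level `p^k`, index `≥ k + j` — IRREDUCIBLE image containing `−1`.** tam3-p1's
`exists_kolyvaginPrime_addOrderOf_localization_eq_shift` verbatim with `(hρ : ρ̄ onto)` replaced by
`(hirr : E[p] irreducible)`, `(hneg : −1 ∈ ρ̄_{E,p}(Γ_ℚ))` and Gross's disjointness prime `q ∣ d_K`, `q ∤ N_E`,
`q ≠ p` (for a Heegner field: any prime factor of `d_K`). For `τ`-eigenclasses `x` (sign `e`) and `y ≠ 0` (sign `−e`)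
in `H¹(K, E[p^k])` and any bound `b`: a Zhang–Kolyvagin prime `ℓ > b` of index `≥ k + j` whose localisation preserves
the orders of `x` and `y`. [cite: Jetchev2008, Lemma 5.1 (p. 821), Rem. 6.2] [cite: McCallumLMS1991, §3 Cor. 3.2, §4 Lemma 4.6] -/
theorem exists_kolyvaginPrime_addOrderOf_localization_eq_shift_of_irr_of_neg
    (hK : IsImaginaryQuadratic K) {p : ℕ} [Fact p.Prime] (hp2 : p ≠ 2)
    (hirr : W.HasIrreducibleModPGaloisRep p)
    (hneg : ∃ γ : Field.absoluteGaloisGroup ℚ, ∀ P : geomTorsion W p, γ • P = -P)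
    {q : ℕ} (hq : q.Prime) (hqd : (q : ℤ) ∣ NumberField.discr K) (hqN : ¬ q ∣ W.conductorNorm ℤ) (hqp : q ≠ p)
    (τ : K ≃ₐ[ℚ] K) (hτ : τ ≠ 1) {k : ℕ} (hk : 1 ≤ k) (j : ℕ)
    {e : ℤ} (he : e = 1 ∨ e = -1)
    (x y : galH1Torsion (W.baseChange K) ((p ^ k : ℕ) : ℤ))
    (hx : conjAct W τ ((p ^ k : ℕ) : ℤ) x = e • x) (hy : conjAct W τ ((p ^ k : ℕ) : ℤ) y = (-e) • y)
    (hy0 : y ≠ 0) (b : ℕ) :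
    ∃ ℓ : ℕ, b < ℓ ∧ Zhang2014.IsKolyvaginPrime (W.conductorNorm ℤ) W K p ℓ ∧
      k + j ≤ Zhang2014.kolyvaginIndex W p ℓ ∧
      ∀ v : HeightOneSpectrum (𝓞 K), (ℓ : 𝓞 K) ∈ v.asIdeal →
        addOrderOf (galoisCohomology.localization
            ((W.baseChange K).torsionGaloisModule ((p ^ k : ℕ) : ℤ)) (Sum.inr v) 1 x) = addOrderOf x ∧
        addOrderOf (galoisCohomology.localization
            ((W.baseChange K).torsionGaloisModule ((p ^ k : ℕ) : ℤ)) (Sum.inr v) 1 y) = addOrderOf y := by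
  have hp : p.Prime := Fact.out
  -- every class is killed by `p^k`, so orders are powers of `p` (and prime to `2`)
  have hkill : ∀ z : galH1Torsion (W.baseChange K) ((p ^ k : ℕ) : ℤ), p ^ k • z = 0 := fun z ↦
    galoisCohomology.nsmul_eq_zero_of_forall ((W.baseChange K).torsionGaloisModule ((p ^ k : ℕ) : ℤ))
      (fun T ↦ by
        have h := (W.baseChange K).natAbs_nsmul_geomTorsion T
        rwa [Int.natAbs_natCast] at h) z
  have hordpow : ∀ z : galH1Torsion (W.baseChange K) ((p ^ k : ℕ) : ℤ), ∃ a ≤ k, addOrderOf z = p ^ a :=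
    fun z ↦ (Nat.dvd_prime_pow hp).mp (addOrderOf_dvd_of_nsmul_eq_zero (hkill z))
  have hcop2 : ∀ z : galH1Torsion (W.baseChange K) ((p ^ k : ℕ) : ℤ), (addOrderOf z).Coprime 2 := by
    intro z
    obtain ⟨a, -, ha⟩ := hordpow z
    rw [ha]
    exact Nat.Coprime.pow_left _ ((Nat.coprime_primes hp Nat.prime_two).mpr hp2)
  let loc : ∀ v : HeightOneSpectrum (𝓞 K), galH1Torsion (W.baseChange K) ((p ^ k : ℕ) : ℤ) →+
      galoisCohomology (((W.baseChange K).torsionGaloisModule ((p ^ k : ℕ) : ℤ)).toLocal (Sum.inr v)) 1 :=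
    fun v ↦ galoisCohomology.localization ((W.baseChange K).torsionGaloisModule ((p ^ k : ℕ) : ℤ))
      (Sum.inr v) 1
  have hloc : ∀ (v : HeightOneSpectrum (𝓞 K)) (z : galH1Torsion (W.baseChange K) ((p ^ k : ℕ) : ℤ))
      (a : ℕ), loc v (p ^ a • z) = 0 ↔
        ((p : ℤ) ^ a) • z ∈ (W.baseChange K).torsionLocalKer (v.adicCompletion K) ((p ^ k : ℕ) : ℤ) := by
    intro v z a
    haveI : CharZero (v.adicCompletion K) := charZero_of_injective_algebraMap (algebraMap K _).injective
    have hz : ((p : ℤ) ^ a) • z = p ^ a • z := by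
      rw [← natCast_zsmul]; push_cast; rfl
    rw [hz, mem_torsionLocalKer_iff_res_eq_zero (W := W.baseChange K)
      (E := v.adicCompletion K) (pow_ne_zero k hp.ne_zero)]
    exact Iff.rfl
  have hconv : ∀ (v : HeightOneSpectrum (𝓞 K)) (z : galH1Torsion (W.baseChange K) ((p ^ k : ℕ) : ℤ))
      (a : ℕ), addOrderOf z = p ^ a →
      (((p : ℤ) ^ a) • z ∈ (W.baseChange K).torsionLocalKer (v.adicCompletion K) ((p ^ k : ℕ) : ℤ) ∧
        (a ≠ 0 → ((p : ℤ) ^ (a - 1)) • z ∉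
          (W.baseChange K).torsionLocalKer (v.adicCompletion K) ((p ^ k : ℕ) : ℤ))) →
      addOrderOf (loc v z) = addOrderOf z := by
    intro v z a ha ⟨h1, h2⟩
    rw [ha]
    rcases Nat.eq_zero_or_pos a with rfl | hapos
    · have hz : z = 0 := by rw [← AddMonoid.addOrderOf_eq_one_iff, ha, pow_zero]
      rw [hz, map_zero, addOrderOf_zero, pow_zero]
    · obtain ⟨a', rfl⟩ : ∃ a', a = a' + 1 := ⟨a - 1, by omega⟩
      have hfin : p ^ (a' + 1) • loc v z = 0 := by rw [← map_nsmul]; exact (hloc v z _).mpr h1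
      have hnot : ¬ p ^ a' • loc v z = 0 := by
        intro h0
        rw [← map_nsmul] at h0
        exact h2 (by omega) (by simpa using (hloc v z a').mp h0)
      exact addOrderOf_eq_prime_pow hnot hfin
  obtain ⟨b', -, hb'⟩ := hordpow y
  have hey : (-e = 1 ∨ -e = -1) := by rcases he with rfl | rfl <;> norm_num
  have hNof : ∀ (z : galH1Torsion (W.baseChange K) ((p ^ k : ℕ) : ℤ)) (a : ℕ), addOrderOf z = p ^ a →
      a ≠ 0 → ((p : ℤ) ^ (a - 1)) • z ≠ 0 := by
    intro z a ha ha0 h0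
    have hz : ((p : ℤ) ^ (a - 1)) • z = p ^ (a - 1) • z := by
      rw [← natCast_zsmul]; push_cast; rfl
    rw [hz] at h0
    have hlt : p ^ (a - 1) < addOrderOf z := by
      rw [ha]; exact Nat.pow_lt_pow_right hp.one_lt (by omega)
    exact (nsmul_ne_zero_of_lt_addOrderOf (pow_ne_zero _ hp.ne_zero) hlt) h0
  by_cases hx0 : x = 0
  · -- the system `(y)`
    obtain ⟨ℓ, hbℓ, hKol, hfrob, hordloc⟩ :=
      McCallum1991_cor_3_2_pow_shift_of_irr_of_neg (N := W.conductorNorm ℤ) (W := W) rfl hK hp hp2 hirr hneg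
        hq hqd hqN hqp hk j hτ ![y]
        (by intro i; fin_cases i; exact hy0) ![b']
        (by intro i hi; fin_cases i; exact hNof y b' hb' hi)
        (by intro i; fin_cases i; exact ⟨-e, hey, hy⟩)
        (by
          intro a ha i
          fin_cases i
          simpa using ha)
        b
    obtain ⟨hZ, hidx⟩ := zhang_isKolyvaginPrime_of_frobEqFrobInfty W hp (by omega) hKol hfrob
    refine ⟨ℓ, hbℓ, hZ, hidx, fun v hv ↦ ⟨?_, ?_⟩⟩
    · show addOrderOf (loc v x) = addOrderOf x
      rw [hx0, map_zero, addOrderOf_zero, addOrderOf_zero]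
    · exact hconv v y b' hb' (by simpa using hordloc 0 v hv)
  · -- the system `(x, y)`
    obtain ⟨a', -, ha'⟩ := hordpow x
    obtain ⟨ℓ, hbℓ, hKol, hfrob, hordloc⟩ :=
      McCallum1991_cor_3_2_pow_shift_of_irr_of_neg (N := W.conductorNorm ℤ) (W := W) rfl hK hp hp2 hirr hneg
        hq hqd hqN hqp hk j hτ ![x, y]
        (by
          intro i
          fin_cases i
          · exact hx0
          · exact hy0)
        ![a', b']
        (by
          intro i hi
          fin_cases i
          · exact hNof x a' ha' hi
          · exact hNof y b' hb' hi)
        (by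
          intro i
          fin_cases i
          · exact ⟨e, he, hx⟩
          · exact ⟨-e, hey, hy⟩)
        (by
          intro c hc i
          have hc' : c 0 • x + c 1 • y = 0 := by simpa [Fin.sum_univ_two] using hc
          obtain ⟨h0, h1⟩ := JET.dvd_of_zsmul_add_zsmul_eq_zero_of_eigen
            (conjAct W τ ((p ^ k : ℕ) : ℤ)) he hx hy (hcop2 x) (hcop2 y) hc'
          fin_cases i
          · simpa using addOrderOf_dvd_iff_zsmul_eq_zero.mp h0
          · simpa using addOrderOf_dvd_iff_zsmul_eq_zero.mp h1)
        b
    obtain ⟨hZ, hidx⟩ := zhang_isKolyvaginPrime_of_frobEqFrobInfty W hp (by omega) hKol hfrob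
    refine ⟨ℓ, hbℓ, hZ, hidx, fun v hv ↦ ⟨?_, ?_⟩⟩
    · exact hconv v x a' ha' (by simpa using hordloc 0 v hv)
    · exact hconv v y b' hb' (by simpa using hordloc 1 v hv)

end Summit.BirchSwinnertonDyer.Rank1Residual.X11b.Three.Koly

end
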